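import Mathlib
import Literature.RingTheory.HopfAlgebra.FiniteDualHopfAlgebra
import Literature.RingTheory.HopfAlgebra.FiniteDualSubalgebra
import HarnessLib

/-!
# The transpose of a bialgebra map ∕ equivalence between finite free bialgebras is a bialgebra map ∕ equivalence of the duals
(Tate, *Finite flat group schemes* (in Cornell–Silverman–Stevens 1997), §(3.8) «The dual Hopf algebra and Cartier duality», pp. 145–146:
«`G ↦ G^D` is a contravariant functor … an anti-equivalence»; Montgomery, *Hopf algebras and their actions on rings*, CBMS 82 (1993), 9.1.3)

Topic `RingTheory/HopfAlgebra`; namespace `Literature.RingTheory.HopfAlgebra.FiniteDual`.  DEFINITIONS with bodies (`transposeAlgHom`,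
`transposeBialgHom`, `transposeBialgEquiv`) + THEOREMS; no instance, no notation, no named fact, no `sorry`.  Imports ★ CD1 `FiniteDualHopfAlgebra`
(the reducible non-instance structures `FiniteDual.coalgebra ∕ bialgebra`, installed with `letI` INSIDE each statement as in that file) and ★ CD3
`FiniteDualQuotient` ∕ `FiniteDualSubalgebra` (transpose along a coalgebra map is multiplicative for convolution; transpose of an algebra map
commutes with the dual comultiplications — both in hypothesis style; THIS FILE BUNDLES THEM).  Cell `pub/hodgecm-mathlib` (D-0151), programme P6
«MOD» (crux item stmt-HodgeConjecture-24832), HEART organ (g1) «scheme dress of Cartier duality», FILE 5a of the B-p04 (g37) plan (input of the bidual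
`(G^D)^D ≅ G`: transport of the dual along `Γ(G^D) ≃ₐc Γ(G)^*`).  Road- and floor-independent commutative algebra; changes no count: HC_CM is proved
only modulo the printed citations until rung 0 closes.

SETTING.  `R` a commutative semiring, `B₁, B₂, B₃` bialgebras over `R`; `W_i := WithConv (Module.Dual R B_i)` with Mathlib's convolution algebra
and (for `B_i` finite free) the dual coalgebra ∕ bialgebra `FiniteDual.coalgebra ∕ bialgebra R B_i`.

* §1 **`transposeAlgHom φ : W₂ →ₐ[R] W₁`** for a bialgebra map `φ : B₁ →ₐc[R] B₂` (`f ↦ f ∘ φ`; multiplicative because `φ` is a coalgebra map —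
  ★ `convOne_∕convMul_comp_coalgHom`), `transposeAlgHom_apply_apply`, `transposeAlgHom_id`, `transposeAlgHom_comp`; for an equivalence `e`,
  `transposeAlgHom e.symm` is a two-sided inverse (`transposeAlgHom_symm_apply_apply`, `…_apply_symm_apply`, `transposeAlgHom_bijective`).
* §2 (finite free) **`comul_comp_transposeAlgHom`**, **`counit_comp_transposeAlgHom`** (★ `dualComul_∕dualCounit_comp_transpose`: because `φ` is an
  algebra map) and **`transposeBialgHom φ : W₂ →ₐc[R] W₁`**.
* §3 **`transposeBialgEquiv e : W₂ ≃ₐc[R] W₁`** for a bialgebra EQUIVALENCE `e : B₁ ≃ₐc[R] B₂` (Mathlib `BialgEquiv.ofBijective`),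
  `transposeBialgEquiv_apply_apply`.

## References
* [Tate1997FiniteFlatGroupSchemes] J. Tate, *Finite flat group schemes*, in: Modular Forms and Fermat's Last Theorem (1997), §(3.8) pp. 145–146.
* [Montgomery1993Hopf] S. Montgomery, *Hopf algebras and their actions on rings*, CBMS 82 (1993), 9.1.3.
-/

set_option autoImplicit false

noncomputable section

open TensorProduct Module WithConv

namespace Literature.RingTheory.HopfAlgebra

namespace FiniteDual

universe u v w x

variable {R : Type u} [CommSemiring R] {B₁ : Type v} {B₂ : Type w} {B₃ : Type x} [Semiring B₁] [Bialgebra R B₁] [Semiring B₂] [Bialgebra R B₂]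
  [Semiring B₃] [Bialgebra R B₃]

/-! ## §1 The transpose of a bialgebra map is an algebra map of the convolution algebras -/

/-- **The transpose `f ↦ f ∘ φ` of a bialgebra map `φ : B₁ → B₂`**, as an ALGEBRA map `B₂^* → B₁^*` of Mathlib's convolution algebras
(multiplicative because `φ` is a coalgebra map: ★ `convMul_comp_coalgHom`; unital: ★ `convOne_comp_coalgHom`).
[cite: Tate1997FiniteFlatGroupSchemes, §(3.8) p. 145] -/
def transposeAlgHom (φ : B₁ →ₐc[R] B₂) : WithConv (Module.Dual R B₂) →ₐ[R] WithConv (Module.Dual R B₁) :=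
  AlgHom.ofLinearMap
    { toFun := fun f => toConv (f.ofConv ∘ₗ (φ : B₁ →ₗc[R] B₂).toLinearMap)
      map_add' := fun f g => by apply ofConv_injective; ext b; simp
      map_smul' := fun r f => by apply ofConv_injective; ext b; simp }
    (by
      apply ofConv_injective
      exact convOne_comp_coalgHom (A := R) (φ : B₁ →ₗc[R] B₂))
    (fun f g => convMul_comp_coalgHom (A := R) (φ : B₁ →ₗc[R] B₂) f g)

/-- `(transposeAlgHom φ f) x = f (φ x)`. [cite: Tate1997FiniteFlatGroupSchemes, §(3.8) p. 145] -/
@[simp] theorem transposeAlgHom_apply_apply (φ : B₁ →ₐc[R] B₂) (f : WithConv (Module.Dual R B₂)) (x : B₁) :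
    transposeAlgHom φ f x = f (φ x) := rfl

/-- `(transposeAlgHom φ f).ofConv = f.ofConv ∘ φ`. [cite: Tate1997FiniteFlatGroupSchemes, §(3.8) p. 145] -/
theorem ofConv_transposeAlgHom (φ : B₁ →ₐc[R] B₂) (f : WithConv (Module.Dual R B₂)) :
    (transposeAlgHom φ f).ofConv = f.ofConv ∘ₗ (φ : B₁ →ₗc[R] B₂).toLinearMap := rfl

/-- **`transpose id = id`.** [cite: Tate1997FiniteFlatGroupSchemes, §(3.8) p. 145] -/
theorem transposeAlgHom_id : transposeAlgHom (BialgHom.id R B₁) = AlgHom.id R (WithConv (Module.Dual R B₁)) :=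
  AlgHom.ext fun _ => WithConv.ext (LinearMap.ext fun _ => rfl)

/-- **`transpose (ψ ∘ φ) = transpose φ ∘ transpose ψ`** (contravariance). [cite: Tate1997FiniteFlatGroupSchemes, §(3.8) p. 145] -/
theorem transposeAlgHom_comp (φ : B₁ →ₐc[R] B₂) (ψ : B₂ →ₐc[R] B₃) :
    transposeAlgHom (ψ.comp φ) = (transposeAlgHom φ).comp (transposeAlgHom ψ) :=
  AlgHom.ext fun _ => WithConv.ext (LinearMap.ext fun _ => rfl)

/-- `transposeAlgHom e.symm` is a left inverse of `transposeAlgHom e`. [cite: Tate1997FiniteFlatGroupSchemes, §(3.8) p. 146] -/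
theorem transposeAlgHom_symm_apply_apply (e : B₁ ≃ₐc[R] B₂) (f : WithConv (Module.Dual R B₂)) :
    transposeAlgHom (e.symm : B₂ →ₐc[R] B₁) (transposeAlgHom (e : B₁ →ₐc[R] B₂) f) = f :=
  WithConv.ext (LinearMap.ext fun x => by
    change f (e (e.symm x)) = f x
    rw [BialgEquiv.apply_symm_apply])

/-- `transposeAlgHom e.symm` is a right inverse of `transposeAlgHom e`. [cite: Tate1997FiniteFlatGroupSchemes, §(3.8) p. 146] -/
theorem transposeAlgHom_apply_symm_apply (e : B₁ ≃ₐc[R] B₂) (g : WithConv (Module.Dual R B₁)) :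
    transposeAlgHom (e : B₁ →ₐc[R] B₂) (transposeAlgHom (e.symm : B₂ →ₐc[R] B₁) g) = g :=
  WithConv.ext (LinearMap.ext fun x => by
    change g (e.symm (e x)) = g x
    rw [BialgEquiv.symm_apply_apply])

/-- The transpose of a bialgebra equivalence is bijective. [cite: Tate1997FiniteFlatGroupSchemes, §(3.8) p. 146] -/
theorem transposeAlgHom_bijective (e : B₁ ≃ₐc[R] B₂) : Function.Bijective (transposeAlgHom (e : B₁ →ₐc[R] B₂)) :=
  Function.bijective_iff_has_inverse.mpr
    ⟨transposeAlgHom (e.symm : B₂ →ₐc[R] B₁), transposeAlgHom_symm_apply_apply e, transposeAlgHom_apply_symm_apply e⟩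

/-! ## §2 Finite free: the transpose is a coalgebra map of the dual coalgebras, hence a bialgebra map -/

section Free

variable [Module.Free R B₁] [Module.Finite R B₁] [Module.Free R B₂] [Module.Finite R B₂]

/-- `Algebra.TensorProduct.map g g` agrees with `TensorProduct.map` of the underlying linear maps (checked on pure tensors).
[cite: Tate1997FiniteFlatGroupSchemes, §(3.8) p. 145] -/
private theorem algebraTensorProductMap_apply_eq {A : Type v} {B : Type w} [Semiring A] [Algebra R A] [Semiring B] [Algebra R B]
    (g : A →ₐ[R] B) (x : A ⊗[R] A) : Algebra.TensorProduct.map g g x = TensorProduct.map g.toLinearMap g.toLinearMap x := by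
  induction x using TensorProduct.induction_on with
  | zero => simp
  | tmul a b => simp
  | add x y hx hy => rw [map_add, map_add, hx, hy]

/-- **`m₁^* ∘ φ^* = (φ^* ⊗ φ^*) ∘ m₂^*`**: the transpose commutes with the dual comultiplications because `φ` is MULTIPLICATIVE
(★ CD3-co `dualComul_comp_transpose` at the bundled `FiniteDual.comul`). [cite: Tate1997FiniteFlatGroupSchemes, §(3.8) pp. 145–146] -/
theorem comul_comp_transposeAlgHom (φ : B₁ →ₐc[R] B₂) :
    comul R B₁ ∘ₗ (transposeAlgHom φ).toLinearMap =
      TensorProduct.map (transposeAlgHom φ).toLinearMap (transposeAlgHom φ).toLinearMap ∘ₗ comul R B₂ :=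
  dualComul_comp_transpose (φ := (φ : B₁ →ₐ[R] B₂)) (ev := evalTwo R B₁) (δ := comul R B₁) (ev'' := evalTwo R B₂) (δ'' := comul R B₂)
    evalTwo_tmul evalTwo_comul evalTwo_tmul evalTwo_comul (T := (transposeAlgHom φ).toLinearMap) (fun _ _ => rfl)

omit [Module.Free R B₁] [Module.Finite R B₁] [Module.Free R B₂] [Module.Finite R B₂] in
/-- **`η₁^* ∘ φ^* = η₂^*`**: the transpose commutes with the dual counits because `φ 1 = 1` (★ CD3-co `dualCounit_comp_transpose`).
[cite: Tate1997FiniteFlatGroupSchemes, §(3.8) pp. 145–146] -/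
theorem counit_comp_transposeAlgHom (φ : B₁ →ₐc[R] B₂) :
    counit R B₁ ∘ₗ (transposeAlgHom φ).toLinearMap = counit R B₂ :=
  dualCounit_comp_transpose (φ := (φ : B₁ →ₐ[R] B₂)) (ε := counit R B₁) (ε'' := counit R B₂) counit_apply counit_apply
    (T := (transposeAlgHom φ).toLinearMap) (fun _ _ => rfl)

/-- **HEAD — the transpose of a bialgebra map is a BIALGEBRA map `B₂^* → B₁^*`** of the dual bialgebras `FiniteDual.bialgebra`
(«`G ↦ G^D` is a functor»). [cite: Tate1997FiniteFlatGroupSchemes, §(3.8) pp. 145–146] -/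
def transposeBialgHom (φ : B₁ →ₐc[R] B₂) :
    letI := FiniteDual.bialgebra R B₁
    letI := FiniteDual.bialgebra R B₂
    WithConv (Module.Dual R B₂) →ₐc[R] WithConv (Module.Dual R B₁) :=
  letI := FiniteDual.bialgebra R B₁
  letI := FiniteDual.bialgebra R B₂
  BialgHom.ofAlgHom (transposeAlgHom φ)
    (AlgHom.toLinearMap_injective (counit_comp_transposeAlgHom φ))
    (AlgHom.toLinearMap_injective (LinearMap.ext fun f => by
      rw [AlgHom.toLinearMap_apply, AlgHom.toLinearMap_apply, AlgHom.comp_apply, AlgHom.comp_apply, algebraTensorProductMap_apply_eq]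
      exact (LinearMap.congr_fun (comul_comp_transposeAlgHom φ) f).symm))

/-- `transposeBialgHom φ` is `transposeAlgHom φ` on elements. [cite: Tate1997FiniteFlatGroupSchemes, §(3.8) p. 145] -/
theorem transposeBialgHom_apply (φ : B₁ →ₐc[R] B₂) (f : WithConv (Module.Dual R B₂)) :
    letI := FiniteDual.bialgebra R B₁
    letI := FiniteDual.bialgebra R B₂
    transposeBialgHom φ f = transposeAlgHom φ f := rfl

/-! ## §3 The transpose of a bialgebra equivalence is a bialgebra equivalence -/

/-- **HEAD — the transpose of a bialgebra EQUIVALENCE `e : B₁ ≃ B₂` is a bialgebra equivalence `B₂^* ≃ B₁^*`** of the dual bialgebras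
(«`G ↦ G^D` is an anti-equivalence»: it carries isomorphisms to isomorphisms). [cite: Tate1997FiniteFlatGroupSchemes, §(3.8) p. 146] -/
def transposeBialgEquiv (e : B₁ ≃ₐc[R] B₂) :
    letI := FiniteDual.bialgebra R B₁
    letI := FiniteDual.bialgebra R B₂
    WithConv (Module.Dual R B₂) ≃ₐc[R] WithConv (Module.Dual R B₁) :=
  letI := FiniteDual.bialgebra R B₁
  letI := FiniteDual.bialgebra R B₂
  BialgEquiv.ofBijective (transposeBialgHom (e : B₁ →ₐc[R] B₂)) (transposeAlgHom_bijective e)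

/-- `(transposeBialgEquiv e f) x = f (e x)`. [cite: Tate1997FiniteFlatGroupSchemes, §(3.8) p. 146] -/
theorem transposeBialgEquiv_apply_apply (e : B₁ ≃ₐc[R] B₂) (f : WithConv (Module.Dual R B₂)) (x : B₁) :
    letI := FiniteDual.bialgebra R B₁
    letI := FiniteDual.bialgebra R B₂
    transposeBialgEquiv e f x = f (e x) := rfl

end Free

end FiniteDual

end Literature.RingTheory.HopfAlgebra

end
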